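import Literature.Probability.Percolation.PlanarDuality
import Literature.Topology.PlaneTopology.ArgumentIncrement
import HarnessLib

/-!
# The combinatorial winding number of a closed lattice walk is the winding number of its polygon

Topic `Literature/Probability/LatticeModels` (planar lattice combinatorics of `ℤ²`); a bridge between
two tools of the tree:

* the **combinatorial winding number** `Literature.Probability.Percolation.walkWinding p u` of a
  lattice walk `p` about the point `u + (½, ½)` — the signed number of vertical steps of `p` crossing
  the horizontal half-line from `u + (½, ½)` to the right (`Percolation/PlanarDuality.lean`,
  H. Kesten, *Percolation theory for mathematicians* (1982), §2.2), used by the weak Beurling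
  estimate (`WeakBeurlingEstimate.lean`, hypothesis "no circuit of `S` winds around `p`") and
  throughout the percolation files; and
* the **topological winding number** `Literature.Topology.PlaneTopology.wind` of a loop in
  `ℂ ∖ {0}` with its crossing calculus (`Topology/PlaneTopology/WindingNumber.lean`,
  `ArgumentIncrement.lean`: `Path.crossInc`, "`+2πi` for a straight piece crossing the segment
  `[ℓ, r]` once transversally").

We attach to a lattice walk `p : G.Walk a b` its **polygon** `walkPath p : Path a b` (the
concatenation of the unit segments of its steps) and prove:

* `wind_walkPath_sub_faceCentre` — **for a closed lattice walk `p` and every site `u`,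
  `wind (walkPath p - (u + (½,½))) = walkWinding p u`**: the crossing defect of the polygon
  relative to a long horizontal segment `[u + (½,½), u + (½,½) + N]` is on the one hand
  `2πi · (wind about the left end - wind about the right end)` (`Path.crossInc_loop`), the right
  end being outside a half-plane containing the polygon (winding `0`), and on the other hand the sum
  over the steps of `±2πi` for the vertical steps crossing the segment and `0` for the others
  (`Path.crossInc_segment_of_cross`, `Path.crossInc_eq_zero`), i.e. `2πi · walkWinding p u`;
* `wind_walkPath_sub_toComplex` — the polygon winds equally about `u + (½,½)` and about the
  lattice point `u` itself when `u` is not a vertex of the walk;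
* `wind_walkPath_sub_eq_zero` — a polygon inside an OPEN SIMPLY CONNECTED set `D` does not wind
  about points outside `D` (`z - q` has a continuous logarithm on `D`, Mathlib's
  `Complex.exists_continuousOn_eqOn_exp_comp`); hence
  `walkWinding_eq_zero_of_isSimplyConnected` — **a closed lattice walk whose polygon lies in an
  open simply connected `D` has `walkWinding p u = 0` about every site `u` with `u ∉ D`** — the
  "no circuit winds around the boundary point" hypothesis of `weakBeurling_of_noCircuit` for the
  lattice points of a simply connected domain.

Everything is proved; the only definition is `walkPath` (with its range described by
`exists_mem_segment_of_mem_range_walkPath`). [folklore]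

## References

* H. Kesten, *Percolation theory for mathematicians*, Birkhäuser (1982), §2.2 [Kesten1982].
* L. V. Ahlfors, *Complex Analysis*, 3rd ed. (1979), §4.2.1 (winding numbers and crossings)
  [Ahlfors1979].
-/

noncomputable section

open Set Complex SimpleGraph
open scoped Real
open Literature.Topology.PlaneTopology
open Literature.Probability.Percolation (walkWinding stepWinding StepKind stepKind_of_adj
  walkWinding_nil walkWinding_cons stepWinding_right stepWinding_left stepWinding_up stepWinding_down)

namespace Literature.Probability.LatticeModels

variable {G : SimpleGraph (Site 2)}

/-! ### The polygon of a lattice walk -/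

/-- **The polygon of a lattice walk**: the concatenation of the straight unit segments of its
steps, a path in `ℂ` from the first to the last vertex. [folklore] -/
def walkPath : {a b : Site 2} → G.Walk a b → Path (Site.toComplex a) (Site.toComplex b)
  | _, _, Walk.nil => Path.refl _
  | _, _, Walk.cons' x y _ _ p => (Path.segment (Site.toComplex x) (Site.toComplex y)).trans (walkPath p)

/-- The polygon of the trivial walk is the constant path. [folklore] -/
@[simp] theorem walkPath_nil (a : Site 2) : walkPath (Walk.nil : G.Walk a a) = Path.refl _ := rfl

/-- The polygon of a walk with a first step. [folklore] -/
@[simp] theorem walkPath_cons {a b c : Site 2} (h : G.Adj a b) (p : G.Walk b c) :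
    walkPath (Walk.cons h p) = (Path.segment (Site.toComplex a) (Site.toComplex b)).trans (walkPath p) := rfl

/-- **The points of the polygon**: every point of `walkPath p` lies on the segment between two
vertices of `p` which are equal or adjacent. [folklore] -/
theorem exists_mem_segment_of_mem_range_walkPath {a b : Site 2} (p : G.Walk a b) {z : ℂ}
    (hz : z ∈ range (walkPath p)) :
    ∃ x ∈ p.support, ∃ y ∈ p.support, (x = y ∨ G.Adj x y) ∧
      z ∈ segment ℝ (Site.toComplex x) (Site.toComplex y) := by
  induction p with
  | nil =>
      rw [walkPath_nil, Path.refl_range, mem_singleton_iff] at hz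
      subst hz
      exact ⟨_, by simp, _, by simp, Or.inl rfl, left_mem_segment _ _ _⟩
  | cons h p ih =>
      rename_i x y w
      rw [walkPath_cons, Path.trans_range, mem_union, Path.range_segment] at hz
      rcases hz with hz | hz
      · exact ⟨x, by simp, y, by simp, Or.inr h, hz⟩
      · obtain ⟨x', hx', y', hy', hxy, hz'⟩ := ih hz
        exact ⟨x', by simp [hx'], y', by simp [hy'], hxy, hz'⟩

/-- The vertices of the walk lie on its polygon. [folklore] -/
theorem toComplex_mem_range_walkPath {a b : Site 2} (p : G.Walk a b) {v : Site 2} (hv : v ∈ p.support) :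
    Site.toComplex v ∈ range (walkPath p) := by
  induction p with
  | nil =>
      rw [Walk.support_nil, List.mem_singleton] at hv
      subst hv
      rw [walkPath_nil, Path.refl_range]
      exact mem_singleton _
  | cons h p ih =>
      rename_i x y w
      rw [walkPath_cons, Path.trans_range, Path.range_segment]
      rw [Walk.support_cons, List.mem_cons] at hv
      rcases hv with rfl | hv
      · exact Or.inl (left_mem_segment _ _ _)
      · exact Or.inr (ih hv)

/-! ### Coordinates along lattice edges -/

/-- `Site.toComplex` in coordinates (real and imaginary parts). [folklore] -/
theorem toComplex_re_im (x : Site 2) : (Site.toComplex x).re = (x 0 : ℝ) ∧ (Site.toComplex x).im = (x 1 : ℝ) :=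
  ⟨rfl, rfl⟩

/-- A point of a segment, in coordinates: `z = X + t (Y - X)` with `t ∈ [0, 1]`. [folklore] -/
theorem exists_of_mem_segment {X Y z : ℂ} (hz : z ∈ segment ℝ X Y) :
    ∃ t : ℝ, 0 ≤ t ∧ t ≤ 1 ∧ z.re = X.re + t * (Y.re - X.re) ∧ z.im = X.im + t * (Y.im - X.im) := by
  rw [segment_eq_image'] at hz
  obtain ⟨t, ⟨ht0, ht1⟩, rfl⟩ := hz
  exact ⟨t, ht0, ht1, by simp, by simp⟩

/-- **Points of the polygon of a lattice walk lie on grid lines**: on the segment between two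
equal or adjacent lattice points, one of the two coordinates is an integer — the corresponding
coordinate of the first point. [folklore] -/
theorem re_eq_or_im_eq_of_mem_segment {x y : Site 2} (hxy : x = y ∨ (zdGraph 2).Adj x y) {z : ℂ}
    (hz : z ∈ segment ℝ (Site.toComplex x) (Site.toComplex y)) :
    z.re = (x 0 : ℝ) ∨ z.im = (x 1 : ℝ) := by
  obtain ⟨t, -, -, hre, him⟩ := exists_of_mem_segment hz
  simp only [toComplex_re_im] at hre him
  rcases hxy with rfl | hxy
  · left; rw [hre]; ring
  · rcases stepKind_of_adj hxy with ⟨h0, h1⟩ | ⟨h0, h1⟩ | ⟨h1, h0⟩ | ⟨h1, h0⟩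
    · right; rw [him, h1]; ring
    · right; rw [him, h1]; ring
    · left; rw [hre, h0]; ring
    · left; rw [hre, h0]; ring

/-- **Every point of the polygon is within `1/2` of a vertex.** [folklore] -/
theorem exists_norm_sub_le_half_of_mem_segment {x y : Site 2} (hxy : x = y ∨ (zdGraph 2).Adj x y) {z : ℂ}
    (hz : z ∈ segment ℝ (Site.toComplex x) (Site.toComplex y)) :
    ‖z - Site.toComplex x‖ ≤ 1 / 2 ∨ ‖z - Site.toComplex y‖ ≤ 1 / 2 := by
  obtain ⟨t, ht0, ht1, hre, him⟩ := exists_of_mem_segment hz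
  have hdx : z - Site.toComplex x = (t : ℂ) * (Site.toComplex y - Site.toComplex x) := by
    apply Complex.ext <;> simp [hre, him]
  have hdy : z - Site.toComplex y = ((t - 1 : ℝ) : ℂ) * (Site.toComplex y - Site.toComplex x) := by
    apply Complex.ext <;> simp [hre, him] <;> ring
  have hlen : ‖Site.toComplex y - Site.toComplex x‖ ≤ 1 := by
    rcases hxy with rfl | hxy
    · simp
    · have hsq : ‖Site.toComplex y - Site.toComplex x‖ ^ 2 = 1 := by
        rw [Complex.sq_norm, Complex.normSq_apply]
        simp only [Complex.sub_re, Complex.sub_im, toComplex_re_im]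
        rcases stepKind_of_adj hxy with ⟨h0, h1⟩ | ⟨h0, h1⟩ | ⟨h1, h0⟩ | ⟨h1, h0⟩ <;>
          · rw [h0, h1]; push_cast; ring
      nlinarith [norm_nonneg (Site.toComplex y - Site.toComplex x)]
  rcases le_or_gt t (1 / 2) with ht | ht
  · left
    rw [hdx, norm_mul, Complex.norm_real, Real.norm_eq_abs, abs_of_nonneg ht0]
    nlinarith [norm_nonneg (Site.toComplex y - Site.toComplex x)]
  · right
    rw [hdy, norm_mul, Complex.norm_real, Real.norm_eq_abs, abs_of_nonpos (by linarith)]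
    nlinarith [norm_nonneg (Site.toComplex y - Site.toComplex x)]

/-- A point with no integer coordinate is not on the polygon of a lattice walk. [folklore] -/
theorem not_mem_range_walkPath_of_offGrid {a b : Site 2} (p : (zdGraph 2).Walk a b) {c : ℂ}
    (hre : ∀ n : ℤ, c.re ≠ n) (him : ∀ n : ℤ, c.im ≠ n) : c ∉ range (walkPath p) := by
  intro hc
  obtain ⟨x, -, y, -, hxy, hz⟩ := exists_mem_segment_of_mem_range_walkPath p hc
  rcases re_eq_or_im_eq_of_mem_segment hxy hz with h | h
  · exact hre _ h
  · exact him _ h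

/-- The abscissae of the polygon are bounded by those of the vertices. [folklore] -/
theorem re_le_of_mem_range_walkPath {a b : Site 2} (p : (zdGraph 2).Walk a b) {M : ℝ}
    (hM : ∀ v ∈ p.support, (v 0 : ℝ) ≤ M) {z : ℂ} (hz : z ∈ range (walkPath p)) : z.re ≤ M := by
  obtain ⟨x, hx, y, hy, -, hz⟩ := exists_mem_segment_of_mem_range_walkPath p hz
  obtain ⟨t, ht0, ht1, hre, -⟩ := exists_of_mem_segment hz
  simp only [toComplex_re_im] at hre
  have hx' := hM x hx
  have hy' := hM y hy
  rw [hre]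
  nlinarith

/-! ### Integers and half-integers -/

/-- An integer is not a half-integer. [folklore] -/
theorem intCast_ne_add_half (n m : ℤ) : (n : ℝ) ≠ m + 1 / 2 := by
  intro h
  have h2 : ((2 * n : ℤ) : ℝ) = ((2 * m + 1 : ℤ) : ℝ) := by push_cast; linarith
  have := (Int.cast_inj (α := ℝ)).1 h2
  omega

/-- If `x + t = u + 1/2` with `t ∈ [0, 1]` and `x, u` integers then `x = u`. [folklore] -/
theorem int_eq_of_add_eq_add_half {x u : ℤ} {t : ℝ} (ht0 : 0 ≤ t) (ht1 : t ≤ 1)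
    (h : (x : ℝ) + t = u + 1 / 2) : x = u := by
  have h1 : (x : ℝ) < (u : ℝ) + 1 := by linarith
  have h2 : (u : ℝ) < (x : ℝ) + 1 := by linarith
  have h1' : x < u + 1 := by exact_mod_cast h1
  have h2' : u < x + 1 := by exact_mod_cast h2
  omega

/-- If `u + 1/2 ≤ x` with `x, u` integers then `u + 1 ≤ x`. [folklore] -/
theorem int_add_one_le_of_add_half_le {x u : ℤ} (h : (u : ℝ) + 1 / 2 ≤ x) : u + 1 ≤ x := by
  have h1 : (u : ℝ) < x := by linarith
  have h1' : u < x := by exact_mod_cast h1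
  omega

/-! ### The crossing defect of the polygon relative to a horizontal segment off the grid -/

/-- The side functional of a horizontal segment `[ℓ, ℓ + N]` is `-N (Im z - Im ℓ)`: positive
below the segment, negative above. [folklore] -/
theorem segSide_horizontal (ℓ : ℂ) (N : ℝ) (z : ℂ) :
    segSide ℓ (ℓ + N) z = -N * (z.im - ℓ.im) := by
  simp only [segSide, Complex.mul_im, Complex.sub_re, Complex.sub_im, Complex.conj_re,
    Complex.conj_im, Complex.add_re, Complex.add_im, Complex.ofReal_re, Complex.ofReal_im]
  ring

/-- Points of the horizontal segment `[ℓ, ℓ + N]`, `N ≥ 0`, in coordinates. [folklore] -/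
theorem im_eq_of_mem_segment_horizontal {ℓ : ℂ} {N : ℝ} (hN : 0 ≤ N) {z : ℂ}
    (hz : z ∈ segment ℝ ℓ (ℓ + N)) : z.im = ℓ.im ∧ ℓ.re ≤ z.re ∧ z.re ≤ ℓ.re + N := by
  obtain ⟨t, ht0, ht1, hre, him⟩ := exists_of_mem_segment hz
  simp only [Complex.add_re, Complex.add_im, Complex.ofReal_re, Complex.ofReal_im, add_zero,
    add_sub_cancel_left] at hre him
  refine ⟨by rw [him]; ring, by rw [hre]; nlinarith, by rw [hre]; nlinarith⟩

/-- **For `ℓ, r` off the grid lines, the crossing defect of the polygon of a lattice walk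
relative to `[ℓ, r]` is the sum of the crossing defects of its steps.** [folklore] -/
theorem crossInc_walkPath {a b : Site 2} (p : (zdGraph 2).Walk a b) {ℓ r : ℂ}
    (hℓre : ∀ n : ℤ, ℓ.re ≠ n) (hℓim : ∀ n : ℤ, ℓ.im ≠ n) (hrre : ∀ n : ℤ, r.re ≠ n)
    (hrim : ∀ n : ℤ, r.im ≠ n) :
    (walkPath p).crossInc ℓ r =
      (p.darts.map fun d => (Path.segment (Site.toComplex d.fst) (Site.toComplex d.snd)).crossInc ℓ r).sum := by
  induction p with
  | nil => simp [Path.crossInc_refl]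
  | cons h p ih =>
      rename_i x y w
      have hseg : ∀ {c : ℂ}, (∀ n : ℤ, c.re ≠ n) → (∀ n : ℤ, c.im ≠ n) →
          c ∉ range (Path.segment (Site.toComplex x) (Site.toComplex y)) := by
        intro c hcre hcim hc
        rw [Path.range_segment] at hc
        rcases re_eq_or_im_eq_of_mem_segment (Or.inr h) hc with h' | h'
        · exact hcre _ h'
        · exact hcim _ h'
      rw [walkPath_cons, Path.crossInc_trans _ _ (hseg hℓre hℓim)
        (not_mem_range_walkPath_of_offGrid p hℓre hℓim) (hseg hrre hrim)
        (not_mem_range_walkPath_of_offGrid p hrre hrim), ih, Walk.darts_cons, List.map_cons,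
        List.sum_cons]

/-- **The crossing defect of one lattice step relative to the horizontal segment from
`u + (½, ½)` to `u + (½ + N, ½)`** is `2πi · stepWinding u x y`: `+2πi` for an up-step across
the segment, `-2πi` for a down-step across it, `0` otherwise (for steps with abscissae
`≤ u₀ + N`). [folklore] -/
theorem crossInc_segment_step (u : Site 2) {N : ℕ} {x y : Site 2} (hxy : (zdGraph 2).Adj x y)
    (hx : x 0 ≤ u 0 + N) (hy : y 0 ≤ u 0 + N) :
    (Path.segment (Site.toComplex x) (Site.toComplex y)).crossInc
        ⟨(u 0 : ℝ) + 1 / 2, (u 1 : ℝ) + 1 / 2⟩ (⟨(u 0 : ℝ) + 1 / 2, (u 1 : ℝ) + 1 / 2⟩ + (N : ℝ)) =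
      stepWinding u x y * (2 * π * I) := by
  set ℓ : ℂ := ⟨(u 0 : ℝ) + 1 / 2, (u 1 : ℝ) + 1 / 2⟩ with hℓ
  have hℓre : ℓ.re = (u 0 : ℝ) + 1 / 2 := rfl
  have hℓim : ℓ.im = (u 1 : ℝ) + 1 / 2 := rfl
  have hN0 : (0 : ℝ) ≤ N := N.cast_nonneg
  -- coordinates of the points of the step
  have hpt : ∀ t : unitInterval, ∃ s : ℝ, 0 ≤ s ∧ s ≤ 1 ∧
      ((Path.segment (Site.toComplex x) (Site.toComplex y)) t).re = (x 0 : ℝ) + s * ((y 0 : ℝ) - x 0) ∧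
      ((Path.segment (Site.toComplex x) (Site.toComplex y)) t).im = (x 1 : ℝ) + s * ((y 1 : ℝ) - x 1) := by
    intro t
    have hmem : (Path.segment (Site.toComplex x) (Site.toComplex y)) t ∈
        segment ℝ (Site.toComplex x) (Site.toComplex y) := by
      rw [← Path.range_segment]; exact mem_range_self t
    obtain ⟨s, hs0, hs1, hre, him⟩ := exists_of_mem_segment hmem
    exact ⟨s, hs0, hs1, hre, him⟩
  rcases stepKind_of_adj hxy with ⟨h0, h1⟩ | ⟨h0, h1⟩ | ⟨h1, h0⟩ | ⟨h1, h0⟩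
  · -- right step: horizontal, no crossing
    rw [stepWinding_right h0, Int.cast_zero, zero_mul]
    refine Path.crossInc_eq_zero _ fun t ht => ?_
    obtain ⟨s, -, -, -, him⟩ := hpt t
    obtain ⟨him', -, -⟩ := im_eq_of_mem_segment_horizontal hN0 ht
    rw [him', hℓim, h1, sub_self, mul_zero, add_zero] at him
    exact intCast_ne_add_half (x 1) (u 1) him.symm
  · -- left step
    rw [stepWinding_left h0, Int.cast_zero, zero_mul]
    refine Path.crossInc_eq_zero _ fun t ht => ?_
    obtain ⟨s, -, -, -, him⟩ := hpt t
    obtain ⟨him', -, -⟩ := im_eq_of_mem_segment_horizontal hN0 ht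
    rw [him', hℓim, h1, sub_self, mul_zero, add_zero] at him
    exact intCast_ne_add_half (x 1) (u 1) him.symm
  · -- up step: `(x₀, x₁) → (x₀, x₁ + 1)`
    rw [stepWinding_up h1 h0]
    by_cases hc : x 1 = u 1 ∧ u 0 + 1 ≤ x 0
    · rw [if_pos hc, Int.cast_one, one_mul]
      refine Path.crossInc_segment_of_cross ?_ ?_ ?_
      · rw [segSide_horizontal, (toComplex_re_im x).2, hℓim, hc.1]
        have : (0 : ℝ) < N := by
          have : u 0 + 1 ≤ u 0 + (N : ℤ) := hc.2.trans hx
          exact_mod_cast (by omega : (0 : ℤ) < N)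
        nlinarith
      · rw [segSide_horizontal, (toComplex_re_im y).2, hℓim, h1, hc.1]
        push_cast
        have : (0 : ℝ) < N := by
          have : u 0 + 1 ≤ u 0 + (N : ℤ) := hc.2.trans hx
          exact_mod_cast (by omega : (0 : ℤ) < N)
        nlinarith
      · -- the crossing point `(x₀, u₁ + ½)`
        refine ⟨⟨(x 0 : ℝ), (u 1 : ℝ) + 1 / 2⟩, ?_, ?_⟩
        · rw [segment_eq_image']
          refine ⟨1 / 2, ⟨by norm_num, by norm_num⟩, ?_⟩
          apply Complex.ext <;> simp [h0, h1, hc.1]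
        · rw [openSegment_eq_image']
          have hNpos : (0 : ℝ) < N := by
            have : u 0 + 1 ≤ u 0 + (N : ℤ) := hc.2.trans hx
            exact_mod_cast (by omega : (0 : ℤ) < N)
          refine ⟨((x 0 : ℝ) - u 0 - 1 / 2) / N, ⟨div_pos ?_ hNpos, ?_⟩, ?_⟩
          · have : (u 0 : ℝ) + 1 ≤ x 0 := by exact_mod_cast hc.2
            linarith
          · rw [div_lt_one hNpos]
            have : (x 0 : ℝ) ≤ u 0 + N := by exact_mod_cast hx
            linarith
          · apply Complex.ext
            · simp [hℓre]
              field_simp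
              ring
            · simp [hℓim]
    · rw [if_neg hc, Int.cast_zero, zero_mul]
      refine Path.crossInc_eq_zero _ fun t ht => ?_
      obtain ⟨s, hs0, hs1, hre, him⟩ := hpt t
      obtain ⟨him', hre1, -⟩ := im_eq_of_mem_segment_horizontal hN0 ht
      rw [h0, sub_self, mul_zero, add_zero] at hre
      rw [him', hℓim, h1] at him
      push_cast at him
      have hx1 : x 1 = u 1 :=
        int_eq_of_add_eq_add_half hs0 hs1 (by linarith)
      rw [hre, hℓre] at hre1
      exact hc ⟨hx1, int_add_one_le_of_add_half_le hre1⟩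
  · -- down step: `(x₀, y₁ + 1) → (x₀, y₁)`
    rw [stepWinding_down h1 h0]
    by_cases hc : y 1 = u 1 ∧ u 0 + 1 ≤ y 0
    · rw [if_pos hc, Int.cast_neg, Int.cast_one, neg_one_mul]
      refine Path.crossInc_segment_of_cross' ?_ ?_ ?_
      · rw [segSide_horizontal, (toComplex_re_im x).2, hℓim, h1, hc.1]
        push_cast
        have : (0 : ℝ) < N := by
          have : u 0 + 1 ≤ u 0 + (N : ℤ) := hc.2.trans hy
          exact_mod_cast (by omega : (0 : ℤ) < N)
        nlinarith
      · rw [segSide_horizontal, (toComplex_re_im y).2, hℓim, hc.1]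
        have : (0 : ℝ) < N := by
          have : u 0 + 1 ≤ u 0 + (N : ℤ) := hc.2.trans hy
          exact_mod_cast (by omega : (0 : ℤ) < N)
        nlinarith
      · refine ⟨⟨(y 0 : ℝ), (u 1 : ℝ) + 1 / 2⟩, ?_, ?_⟩
        · rw [segment_eq_image']
          refine ⟨1 / 2, ⟨by norm_num, by norm_num⟩, ?_⟩
          apply Complex.ext <;> simp [h0, h1, hc.1]
          ring
        · rw [openSegment_eq_image']
          have hNpos : (0 : ℝ) < N := by
            have : u 0 + 1 ≤ u 0 + (N : ℤ) := hc.2.trans hy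
            exact_mod_cast (by omega : (0 : ℤ) < N)
          refine ⟨((y 0 : ℝ) - u 0 - 1 / 2) / N, ⟨div_pos ?_ hNpos, ?_⟩, ?_⟩
          · have : (u 0 : ℝ) + 1 ≤ y 0 := by exact_mod_cast hc.2
            linarith
          · rw [div_lt_one hNpos]
            have : (y 0 : ℝ) ≤ u 0 + N := by exact_mod_cast hy
            linarith
          · apply Complex.ext
            · simp [hℓre]
              field_simp
              ring
            · simp [hℓim]
    · rw [if_neg hc, neg_zero, Int.cast_zero, zero_mul]
      refine Path.crossInc_eq_zero _ fun t ht => ?_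
      obtain ⟨s, hs0, hs1, hre, him⟩ := hpt t
      obtain ⟨him', hre1, -⟩ := im_eq_of_mem_segment_horizontal hN0 ht
      rw [h0, sub_self, mul_zero, add_zero] at hre
      rw [him', hℓim, h1] at him
      push_cast at him
      have hy1 : y 1 = u 1 :=
        int_eq_of_add_eq_add_half (t := 1 - s) (by linarith) (by linarith) (by linarith)
      rw [hre, hℓre] at hre1
      exact hc ⟨hy1, by rw [h0]; exact int_add_one_le_of_add_half_le hre1⟩

/-! ### The winding number of the polygon of a closed walk about a face centre -/

/-- `walkWinding` as a complex-valued sum over the steps. [folklore] -/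
theorem cast_walkWinding_eq_sum {a b : Site 2} (p : G.Walk a b) (u : Site 2) :
    ((walkWinding p u : ℤ) : ℂ) = (p.darts.map fun d => ((stepWinding u d.fst d.snd : ℤ) : ℂ)).sum := by
  simp only [walkWinding]
  rw [Int.cast_list_sum, List.map_map]
  rfl

/-- `z ↦ z - r` has a continuous logarithm on the half-plane `{Re z < Re r}`. [folklore] -/
theorem hasLogOn_sub_of_re_lt (r : ℂ) : HasLogOn (fun z : ℂ => z - r) {z | z.re < r.re} := by
  refine ⟨fun z => Complex.log (r - z) + π * I, ?_, ?_⟩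
  · refine ContinuousOn.add (ContinuousOn.clog (continuousOn_const.sub continuousOn_id) ?_) continuousOn_const
    intro z hz
    rw [Complex.mem_slitPlane_iff]
    left
    rw [Complex.sub_re]
    exact sub_pos.2 hz
  · intro z hz
    have hne : r - z ≠ 0 := by
      intro h
      have h' := congrArg Complex.re h
      rw [Complex.sub_re, Complex.zero_re] at h'
      have : z.re < r.re := hz
      linarith
    rw [Complex.exp_add, Complex.exp_log hne, Complex.exp_pi_mul_I]
    ring

/-- **The combinatorial winding number is the winding number of the polygon.** For a closed
lattice walk `p` and every site `u`, the winding number of the polygon `walkPath p` about the face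
centre `u + (½, ½)` is `walkWinding p u`. [folklore] -/
theorem wind_walkPath_sub_faceCentre {a : Site 2} (p : (zdGraph 2).Walk a a) (u : Site 2) :
    wind (fun t => (walkPath p).extend t - ⟨(u 0 : ℝ) + 1 / 2, (u 1 : ℝ) + 1 / 2⟩) = walkWinding p u := by
  set ℓ : ℂ := ⟨(u 0 : ℝ) + 1 / 2, (u 1 : ℝ) + 1 / 2⟩ with hℓ
  -- a bound for the abscissae of the vertices
  obtain ⟨N, hbound⟩ : ∃ N : ℕ, ∀ v ∈ p.support, v 0 ≤ u 0 + N := by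
    refine ⟨(p.support.map fun v => (v 0 - u 0).toNat).sum, fun v hv => ?_⟩
    have h1 : (v 0 - u 0).toNat ≤ (p.support.map fun v => (v 0 - u 0).toNat).sum :=
      List.single_le_sum (fun _ _ => Nat.zero_le _) _ (List.mem_map.2 ⟨v, hv, rfl⟩)
    have h2 : v 0 - u 0 ≤ ((v 0 - u 0).toNat : ℤ) := Int.self_le_toNat _
    omega
  set r : ℂ := ℓ + (N : ℝ) with hr
  have hℓre : ∀ n : ℤ, ℓ.re ≠ n := fun n h => intCast_ne_add_half n (u 0) h.symm
  have hℓim : ∀ n : ℤ, ℓ.im ≠ n := fun n h => intCast_ne_add_half n (u 1) h.symm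
  have hrre' : r.re = ((u 0 + N : ℤ) : ℝ) + 1 / 2 := by
    simp only [hr, hℓ, Complex.add_re, Complex.ofReal_re]
    push_cast
    ring
  have hrre : ∀ n : ℤ, r.re ≠ n := fun n h => intCast_ne_add_half n (u 0 + N) (by rw [← hrre', h])
  have hrim : ∀ n : ℤ, r.im ≠ n := fun n h => intCast_ne_add_half n (u 1) (by
    rw [← h]; simp [hr, hℓ])
  have hℓrange : ℓ ∉ range (walkPath p) := not_mem_range_walkPath_of_offGrid p hℓre hℓim
  have hrrange : r ∉ range (walkPath p) := not_mem_range_walkPath_of_offGrid p hrre hrim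
  -- (A) the crossing defect is the sum over the steps, i.e. `2πi · walkWinding`
  have hA := crossInc_walkPath p hℓre hℓim hrre hrim
  have hsteps : (p.darts.map fun d =>
      (Path.segment (Site.toComplex d.fst) (Site.toComplex d.snd)).crossInc ℓ r).sum =
      (p.darts.map fun d => ((stepWinding u d.fst d.snd : ℤ) : ℂ) * (2 * π * I)).sum := by
    congr 1
    refine List.map_congr_left fun d hd => ?_
    exact crossInc_segment_step u d.adj (hbound _ (Walk.dart_fst_mem_support_of_mem_darts _ hd))
      (hbound _ (Walk.dart_snd_mem_support_of_mem_darts _ hd))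
  rw [hsteps, List.sum_map_mul_right, ← cast_walkWinding_eq_sum] at hA
  -- (B) the crossing defect is `2πi (wind about ℓ - wind about r)`, and the latter vanishes
  have hB := Path.crossInc_loop (walkPath p) hℓrange hrrange
  have hwr : wind (fun t => (walkPath p).extend t - r) = 0 := by
    refine wind_comp_eq_zero_of_hasLogOn (hasLogOn_sub_of_re_lt r) (γ := (walkPath p).extend)
      (walkPath p).continuous_extend.continuousOn (fun t ht => ?_) (by rw [Path.extend_zero, Path.extend_one])
    have hmem : (walkPath p).extend t ∈ range (walkPath p) := by
      rw [Path.extend_apply _ ht]; exact mem_range_self _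
    have hle := re_le_of_mem_range_walkPath p (M := (u 0 : ℝ) + N)
      (fun v hv => by exact_mod_cast hbound v hv) hmem
    show ((walkPath p).extend t).re < r.re
    rw [hrre']
    push_cast
    linarith
  rw [hwr, Int.cast_zero, sub_zero] at hB
  exact int_eq_of_mul_two_pi_I_eq (hB.symm.trans hA)

/-- A lattice point on a lattice edge (or a degenerate edge) is one of its ends. [folklore] -/
theorem eq_or_eq_of_toComplex_mem_segment {x y u : Site 2} (hxy : x = y ∨ (zdGraph 2).Adj x y)
    (h : Site.toComplex u ∈ segment ℝ (Site.toComplex x) (Site.toComplex y)) : u = x ∨ u = y := by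
  have site_ext : ∀ {v w : Site 2}, v 0 = w 0 → v 1 = w 1 → v = w :=
    fun h0 h1 => by funext i; fin_cases i <;> assumption
  obtain ⟨t, ht0, ht1, hre, him⟩ := exists_of_mem_segment h
  simp only [toComplex_re_im] at hre him
  rcases hxy with rfl | hxy
  · left
    exact site_ext (by exact_mod_cast (by linarith : (u 0 : ℝ) = x 0)) (by exact_mod_cast (by linarith : (u 1 : ℝ) = x 1))
  · rcases stepKind_of_adj hxy with ⟨h0, h1⟩ | ⟨h0, h1⟩ | ⟨h1, h0⟩ | ⟨h1, h0⟩
    · -- right: `u₀ = x₀ + t`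
      rw [h0] at hre; push_cast at hre
      have hu1 : u 1 = x 1 := by exact_mod_cast (by rw [him, h1]; ring : (u 1 : ℝ) = x 1)
      have hk : ((u 0 - x 0 : ℤ) : ℝ) = t := by push_cast; linarith
      have hk0 : 0 ≤ u 0 - x 0 := by exact_mod_cast (hk ▸ ht0 : (0:ℝ) ≤ ((u 0 - x 0 : ℤ) : ℝ))
      have hk1 : u 0 - x 0 ≤ 1 := by exact_mod_cast (hk ▸ ht1 : ((u 0 - x 0 : ℤ) : ℝ) ≤ 1)
      rcases (by omega : u 0 = x 0 ∨ u 0 = x 0 + 1) with hu0 | hu0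
      · exact Or.inl (site_ext hu0 hu1)
      · exact Or.inr (site_ext (by rw [hu0, h0]) (by rw [hu1, h1]))
    · -- left: `u₀ = x₀ - t`
      rw [show (y 0 : ℝ) = x 0 - 1 by have : x 0 = y 0 + 1 := h0; push_cast [this]; ring] at hre
      have hu1 : u 1 = x 1 := by exact_mod_cast (by rw [him, h1]; ring : (u 1 : ℝ) = x 1)
      have hk : ((x 0 - u 0 : ℤ) : ℝ) = t := by push_cast; linarith
      have hk0 : 0 ≤ x 0 - u 0 := by exact_mod_cast (hk ▸ ht0 : (0:ℝ) ≤ ((x 0 - u 0 : ℤ) : ℝ))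
      have hk1 : x 0 - u 0 ≤ 1 := by exact_mod_cast (hk ▸ ht1 : ((x 0 - u 0 : ℤ) : ℝ) ≤ 1)
      rcases (by omega : u 0 = x 0 ∨ u 0 = y 0) with hu0 | hu0
      · exact Or.inl (site_ext hu0 hu1)
      · exact Or.inr (site_ext hu0 (by rw [hu1, h1]))
    · -- up: `u₁ = x₁ + t`
      rw [h1] at him; push_cast at him
      have hu0 : u 0 = x 0 := by exact_mod_cast (by rw [hre, h0]; ring : (u 0 : ℝ) = x 0)
      have hk : ((u 1 - x 1 : ℤ) : ℝ) = t := by push_cast; linarith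
      have hk0 : 0 ≤ u 1 - x 1 := by exact_mod_cast (hk ▸ ht0 : (0:ℝ) ≤ ((u 1 - x 1 : ℤ) : ℝ))
      have hk1 : u 1 - x 1 ≤ 1 := by exact_mod_cast (hk ▸ ht1 : ((u 1 - x 1 : ℤ) : ℝ) ≤ 1)
      rcases (by omega : u 1 = x 1 ∨ u 1 = x 1 + 1) with hu1 | hu1
      · exact Or.inl (site_ext hu0 hu1)
      · exact Or.inr (site_ext (by rw [hu0, h0]) (by rw [hu1, h1]))
    · -- down: `u₁ = x₁ - t`
      rw [show (y 1 : ℝ) = x 1 - 1 by have : x 1 = y 1 + 1 := h1; push_cast [this]; ring] at him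
      have hu0 : u 0 = x 0 := by exact_mod_cast (by rw [hre, h0]; ring : (u 0 : ℝ) = x 0)
      have hk : ((x 1 - u 1 : ℤ) : ℝ) = t := by push_cast; linarith
      have hk0 : 0 ≤ x 1 - u 1 := by exact_mod_cast (hk ▸ ht0 : (0:ℝ) ≤ ((x 1 - u 1 : ℤ) : ℝ))
      have hk1 : x 1 - u 1 ≤ 1 := by exact_mod_cast (hk ▸ ht1 : ((x 1 - u 1 : ℤ) : ℝ) ≤ 1)
      rcases (by omega : u 1 = x 1 ∨ u 1 = y 1) with hu1 | hu1
      · exact Or.inl (site_ext hu0 hu1)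
      · exact Or.inr (site_ext (by rw [hu0, h0]) hu1)

/-- A site which is not a vertex of the walk is not on its polygon. [folklore] -/
theorem toComplex_not_mem_range_walkPath {a b : Site 2} (p : (zdGraph 2).Walk a b) {u : Site 2}
    (hu : u ∉ p.support) : Site.toComplex u ∉ range (walkPath p) := by
  intro h
  obtain ⟨x, hx, y, hy, hxy, hz⟩ := exists_mem_segment_of_mem_range_walkPath p h
  rcases eq_or_eq_of_toComplex_mem_segment hxy hz with rfl | rfl
  exacts [hu hx, hu hy]

/-- **The polygon of a closed lattice walk winds equally about the face centre `u + (½, ½)` and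
about the lattice point `u`**, when `u` is not a vertex of the walk (the segment joining the two
points misses the polygon). [folklore] -/
theorem wind_walkPath_sub_toComplex {a : Site 2} (p : (zdGraph 2).Walk a a) {u : Site 2}
    (hu : u ∉ p.support) :
    wind (fun t => (walkPath p).extend t - Site.toComplex u) = walkWinding p u := by
  rw [← wind_walkPath_sub_faceCentre p u]
  set ℓ : ℂ := ⟨(u 0 : ℝ) + 1 / 2, (u 1 : ℝ) + 1 / 2⟩ with hℓ
  have hurange : Site.toComplex u ∉ range (walkPath p) := toComplex_not_mem_range_walkPath p hu
  have hℓrange : ℓ ∉ range (walkPath p) := not_mem_range_walkPath_of_offGrid p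
    (fun n h => intCast_ne_add_half n (u 0) h.symm) (fun n h => intCast_ne_add_half n (u 1) h.symm)
  -- the segment `[u, ℓ]` misses the polygon
  have h0 : (walkPath p).crossInc (Site.toComplex u) ℓ = 0 := by
    refine Path.crossInc_eq_zero _ fun t ht => ?_
    have hmem : (walkPath p) t ∈ range (walkPath p) := mem_range_self t
    obtain ⟨s, hs0, hs1, hre, him⟩ := exists_of_mem_segment ht
    simp only [toComplex_re_im, hℓ] at hre him
    obtain ⟨x, hx, y, hy, hxy, hz⟩ := exists_mem_segment_of_mem_range_walkPath p hmem
    -- one coordinate of the point is an integer, forcing `s = 0`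
    have hs : s = 0 := by
      rcases re_eq_or_im_eq_of_mem_segment hxy hz with h | h
      · rw [h] at hre
        have hk : ((x 0 - u 0 : ℤ) : ℝ) = s * (1 / 2) := by push_cast; linarith
        have hk0 : 0 ≤ x 0 - u 0 := by
          have : (0 : ℝ) ≤ ((x 0 - u 0 : ℤ) : ℝ) := by rw [hk]; positivity
          exact_mod_cast this
        have hk1 : x 0 - u 0 < 1 := by
          have : ((x 0 - u 0 : ℤ) : ℝ) < 1 := by rw [hk]; linarith
          exact_mod_cast this
        have : x 0 - u 0 = 0 := by omega
        rw [this] at hk; push_cast at hk; linarith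
      · rw [h] at him
        have hk : ((x 1 - u 1 : ℤ) : ℝ) = s * (1 / 2) := by push_cast; linarith
        have hk0 : 0 ≤ x 1 - u 1 := by
          have : (0 : ℝ) ≤ ((x 1 - u 1 : ℤ) : ℝ) := by rw [hk]; positivity
          exact_mod_cast this
        have hk1 : x 1 - u 1 < 1 := by
          have : ((x 1 - u 1 : ℤ) : ℝ) < 1 := by rw [hk]; linarith
          exact_mod_cast this
        have : x 1 - u 1 = 0 := by omega
        rw [this] at hk; push_cast at hk; linarith
    subst hs
    have heq : (walkPath p) t = Site.toComplex u := by
      apply Complex.ext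
      · rw [hre]; simp
      · rw [him]; simp
    exact hurange (heq ▸ hmem)
  have hB := Path.crossInc_loop (walkPath p) hurange hℓrange
  rw [h0] at hB
  have h := int_eq_of_mul_two_pi_I_eq (m := wind fun t => (walkPath p).extend t - Site.toComplex u)
    (n := wind fun t => (walkPath p).extend t - ℓ) (by
      have : ((wind (fun t => (walkPath p).extend t - Site.toComplex u) : ℂ) -
          (wind (fun t => (walkPath p).extend t - ℓ) : ℂ)) * (2 * π * I) = 0 := by
        exact_mod_cast hB.symm
      rw [sub_mul, sub_eq_zero] at this
      exact this)
  exact h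

/-! ### Simply connected domains: no winding about outside points -/

/-- **In an open simply connected set, closed polygons do not wind about outside points**:
`z ↦ z - q` has a continuous logarithm on `D` (Mathlib's `Complex.exists_continuousOn_eqOn_exp_comp`),
so every loop of `D` has winding number `0` about `q ∉ D`. [folklore] -/
theorem wind_walkPath_sub_eq_zero_of_isSimplyConnected {D : Set ℂ} (hD : IsOpen D)
    (hsc : IsSimplyConnected D) {a : Site 2} (p : G.Walk a a) (hp : range (walkPath p) ⊆ D)
    {q : ℂ} (hq : q ∉ D) : wind (fun t => (walkPath p).extend t - q) = 0 := by
  have hlog : HasLogOn (fun z : ℂ => z - q) D := by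
    obtain ⟨g, hg, hge⟩ := Complex.exists_continuousOn_eqOn_exp_comp hsc hD
      (g := fun z : ℂ => z - q) (continuousOn_id.sub continuousOn_const)
      (by
        rintro ⟨z, hz, h⟩
        rw [sub_eq_zero] at h
        exact hq (h ▸ hz))
    exact ⟨g, hg, fun z hz => hge hz⟩
  exact wind_comp_eq_zero_of_hasLogOn hlog (walkPath p).continuous_extend.continuousOn
    (fun t ht => hp (by rw [Path.extend_apply _ ht]; exact mem_range_self _))
    (by rw [Path.extend_zero, Path.extend_one])

/-- The polygon lies in `D` as soon as the open unit discs about the vertices do. [folklore] -/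
theorem range_walkPath_subset_of_ball_subset {D : Set ℂ} {a b : Site 2} (p : (zdGraph 2).Walk a b)
    (h : ∀ v ∈ p.support, Metric.ball (Site.toComplex v) 1 ⊆ D) : range (walkPath p) ⊆ D := by
  intro z hz
  obtain ⟨x, hx, y, hy, hxy, hz'⟩ := exists_mem_segment_of_mem_range_walkPath p hz
  rcases exists_norm_sub_le_half_of_mem_segment hxy hz' with hd | hd
  · exact h x hx (by rw [Metric.mem_ball, dist_eq_norm]; linarith)
  · exact h y hy (by rw [Metric.mem_ball, dist_eq_norm]; linarith)

/-- **Closed lattice walks whose polygon lies in an open simply connected set do not wind about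
lattice points outside it**: `walkWinding p u = 0` for every site `u` with `u ∉ D` — the
"no circuit winds around the boundary point" hypothesis of the weak Beurling estimate
(`weakBeurling_of_noCircuit`) for walks in a simply connected domain. [folklore] -/
theorem walkWinding_eq_zero_of_isSimplyConnected {D : Set ℂ} (hD : IsOpen D)
    (hsc : IsSimplyConnected D) {a : Site 2} (p : (zdGraph 2).Walk a a) (hp : range (walkPath p) ⊆ D)
    {u : Site 2} (hu : Site.toComplex u ∉ D) : walkWinding p u = 0 := by
  have hus : u ∉ p.support := fun h => hu (hp (toComplex_mem_range_walkPath p h))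
  rw [← wind_walkPath_sub_toComplex p hus]
  exact wind_walkPath_sub_eq_zero_of_isSimplyConnected hD hsc p hp hu

end Literature.Probability.LatticeModels
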